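import Mathlib
import HarnessLib
import Summits.NavierStokesRegularity.NavierStokesRegularity.Theorems.CompletionRelayChainRelayFrontStepWakeRates
import Summits.NavierStokesRegularity.NavierStokesRegularity.Theorems.CompletionRelayChainRelayFrontStepBootstrap
import Summits.NavierStokesRegularity.NavierStokesRegularity.Theorems.CompletionRelayChainRelayFrontStepEnergyIncrement

/-!
# `CompletionRelayChain` — crux `RelayFrontStep` (item stmt-NavierStokesRegularity-24850):
  registered stub `stub_wake` of LINE `window_v2` — THE FAR WAKE

Along any `(η,η)`-pseudo-flow of a table with the completion-relay rows, started with the wake ENERGY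
clauses of the repaired window `W₂` (`F₀ i k ≤ wakeE i k` for `k ≤ −1`, modes `i ≠ 3`), and given on
the hop window `[0, τ₁]` (`τ₁ ≤ 8`) the epoch-envelope bound on old shell `−3` (`F i (−3) ≤ relayEnv₂ (−3)
= 16`, the output of the front block), the energies of all old shells `k ≤ −4` stay under the epoch
envelope `relayEnv₂` and the wake energy clauses re-enter, one shell deeper, after rescaling by any
amplitude ratio `a ≥ 17/20` (`stub_wake`, registered signature verbatim).

PROOF. A ONE-SIDED UNIFORM BOOTSTRAP over the family `{F_{i,j} : i ∈ {0,1,2}, j ≤ −4}` with scales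
`wakeE i j = ½C_i²·2^{|j|}` (`C = (0.2, 0.5, 0.08)`), profile `ψ(t) = 1 + t/20` and slack factor
`θ = 169/140` (`RelayFrontStep.bootstrap_family_oneSided_slack`):
* (growth, uniform) the a priori class (4.5) bounds every amplitude by one `M`, the clocks `2^{5j/2}`,
  `2^{5(j−1)/2}` are `≤ 1`, so `∂F ≤ quadTerm·S ≤ 3M³ ≤ L·wakeE i j` (`wakeE i j ≥ 0.0032`);
* (improve) if `F ≤ θψ·wakeE ≤ 1.69·wakeE` on `[0, t]` for the whole family, then with the amplitude
  scale `q = 2^{|j|/2}` of shell `j` every amplitude entering the row of `(i, j)` is bounded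
  (`|x_j| ≤ 0.26q`, `|u_j| ≤ 0.65q`, `|r_j| ≤ 0.104q`, `|u_{j−1}| ≤ 0.92q`, `|r_{j−1}| ≤ 0.15q`,
  `|x_{j+1}|, |u_{j+1}| ≤ 1.5q` — the last from `relayEnv₂ (−3) = 16` when `j = −4`), the clocks are
  `Λ_j = q^{−5}`, `Λ_{j−1} = 2^{−5/2}q^{−5}`, and the rows give `quadTerm·S ≤ c_i/q²` with
  `c = (0.15, 0.75, 0.007)`; since `q⁴ ≥ 256`, `c_i/q² ≤ wakeE i j/20`, so (4.9) integrated from `0`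
  gives `F(t) ≤ wakeE·(1 + t/20) = ψ(t)·wakeE`.
Conclusion `F_{i,j}(t) ≤ 1.4·wakeE i j` on `[0, τ₁]`: this is `≤ relayEnv₂ j` and, one shell deeper and
divided by `a² ≥ 289/400`, `≤ wakeE i (j−1)·(1.4/(2a²)) ≤ wakeE i (j−1)`.

HONEST FRAMING: MODEL lattice only (Tao 2016 §4 vocabulary); one registered stub of an open crux; the
crux `RelayFrontStep`, the rung TL-M3-R64 and every NS statement remain unproved. Nothing here is a
statement about the Navier–Stokes equations.
-/

noncomputable section

-- the summit-side namespace `Summit.NavierStokesRegularity.NavierStokesRegularity.…` (single-conjunct summit,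
-- D-0017) repeats a component by design; the dupNamespace linter would flag every declaration.
set_option linter.dupNamespace false

open Set MeasureTheory intervalIntegral Literature.Analysis.FluidPDE Literature.Analysis.FluidPDE.TaoCascade
open Summit.NavierStokesRegularity.NavierStokesRegularity.Theorems
open Summit.NavierStokesRegularity.NavierStokesRegularity.Theorems.RelayFrontStep

namespace Summit.NavierStokesRegularity.NavierStokesRegularity.Cruxes.RelayFrontStep.Window2

/-! ### The flow part -/

variable {τ κ₁ κ₂ : ℝ} {α : Fin 4 → Fin 4 → Fin 4 → ℤ × ℤ × ℤ → ℝ}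
  {S₀ F₀ B₀ : Fin 4 → ℤ → ℝ} {S F : Fin 4 → ℤ → ℝ → ℝ}

/-- The a priori class (4.5) bounds every amplitude of a pseudo-flow by one constant `M ≥ 0`.
[cite: Tao2016AveragedNS, §4 Lemma 4.1 (4.5)] -/
theorem wake_apriori_abs (h : PseudoFlowOn τ 1 α κ₁ κ₂ S₀ F₀ B₀ S F) :
    ∃ M : ℝ, 0 ≤ M ∧ ∀ s ∈ Icc 0 τ, ∀ (i : Fin 4) (k : ℤ), |S i k s| ≤ M := by
  obtain ⟨M, hM⟩ := h.apriori_S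
  refine ⟨max M 0, le_max_right _ _, fun s hs i k => ?_⟩
  have h1 := hM s hs i k
  have hw : 1 ≤ 1 + (1 + 1 : ℝ) ^ ((10 : ℝ) * k) := by
    have := Real.rpow_pos_of_pos (by norm_num : (0 : ℝ) < 1 + 1) ((10 : ℝ) * k)
    linarith
  calc |S i k s| = 1 * |S i k s| := (one_mul _).symm
    _ ≤ (1 + (1 + 1 : ℝ) ^ ((10 : ℝ) * k)) * |S i k s| :=
        mul_le_mul_of_nonneg_right hw (abs_nonneg _)
    _ ≤ M := h1
    _ ≤ max M 0 := le_max_left _ _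

/-- CRUDE RATE along the flow: with every amplitude `≤ M`, at and below the front (`j ≤ 0`) the
active rows give `quadTerm·S ≤ 3M³`. [cite: Tao2016AveragedNS, §4 Lemma 4.1 (4.5), (4.9)] -/
theorem wake_crude_rate (h : PseudoFlowOn τ 1 α κ₁ κ₂ S₀ F₀ B₀ S F) (hrows : RelayRows α)
    {M : ℝ} (hM : ∀ s ∈ Icc 0 τ, ∀ (i : Fin 4) (k : ℤ), |S i k s| ≤ M)
    {i : Fin 4} (hi : i ≠ 3) {j : ℤ} (hj : j ≤ 0) {s : ℝ} (hs : s ∈ Icc 0 τ) :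
    quadTerm 1 α S i j s * S i j s ≤ 3 * M ^ 3 := by
  have _h := h
  have hΛ0 : 0 ≤ (1 + 1 : ℝ) ^ ((5 : ℝ) * (j : ℝ) / 2) := (Real.rpow_pos_of_pos (by norm_num) _).le
  have hΛ1 := wake_clock_le_one hj
  have hΛ'0 : 0 ≤ (1 + 1 : ℝ) ^ ((5 : ℝ) * ((j : ℝ) - 1) / 2) :=
    (Real.rpow_pos_of_pos (by norm_num) _).le
  have hΛ'1 := wake_clock_pred_le_one hj
  have hi' : i = 0 ∨ i = 1 ∨ i = 2 := by
    fin_cases i <;> simp_all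
  rcases hi' with rfl | rfl | rfl
  · rw [hrows.1 S j s]
    exact wake_crude_carrier hΛ0 hΛ1 hΛ'0 hΛ'1 (hM s hs 0 j) (hM s hs 1 j) (hM s hs 1 (j - 1))
  · rw [hrows.2.1 S j s]
    exact wake_crude_trigger hΛ0 hΛ1 hΛ'0 hΛ'1 (hM s hs 0 j) (hM s hs 1 j) (hM s hs 2 j)
      (hM s hs 0 (j + 1)) (hM s hs 1 (j - 1)) (hM s hs 2 (j - 1))
  · rw [hrows.2.2.1 S j s]
    exact wake_crude_relay hΛ0 hΛ1 (hM s hs 1 j) (hM s hs 2 j) (hM s hs 0 (j + 1))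
      (hM s hs 1 (j + 1))

/-- FINE RATE under the family hypothesis: if on `[0, t]` every wake energy `F_{i',j'}` (`i' ≠ 3`,
`j' ≤ −4`) is `≤ 1.69·wakeE i' j'` and old shell `−3` carries energy `≤ 16` per active mode, then
for `i ≠ 3`, `j ≤ −4`, `s ∈ [0, t]`: `quadTerm·S ≤ wakeE i j / 20`.
[cite: Tao2016AveragedNS, §4 Lemma 4.1 (4.9), (4.10)] -/
theorem wake_fine_rate (h : PseudoFlowOn τ 1 α κ₁ κ₂ S₀ F₀ B₀ S F) (hrows : RelayRows α)
    {t : ℝ} (ht : t ∈ Icc 0 τ)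
    (hfam : ∀ (i : Fin 4) (j : ℤ), i ≠ 3 → j ≤ -4 → ∀ s ∈ Icc 0 t, F i j s ≤ 169 / 100 * wakeE i j)
    (h3 : ∀ s ∈ Icc 0 t, ∀ i : Fin 4, i ≠ 3 → F i (-3) s ≤ 16)
    {i : Fin 4} (hi : i ≠ 3) {j : ℤ} (hj : j ≤ -4) {s : ℝ} (hs : s ∈ Icc 0 t) :
    quadTerm 1 α S i j s * S i j s ≤ wakeE i j / 20 := by
  have hsτ : s ∈ Icc 0 τ := ⟨hs.1, hs.2.trans ht.2⟩
  -- the amplitude scale of shell `j` and the clocks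
  set q : ℝ := (2 : ℝ) ^ (-(j : ℝ) / 2) with hq_def
  have hq : 0 < q := Real.rpow_pos_of_pos (by norm_num) _
  have hq2 : q ^ 2 = (2 : ℝ) ^ (-(j : ℝ)) := wake_scale_sq j
  have hQ16 : 16 ≤ q ^ 2 := by rw [hq2]; exact wake_scale_sq_ge hj
  have hΛ : (1 + 1 : ℝ) ^ ((5 : ℝ) * (j : ℝ) / 2) = 1 / q ^ 5 := wake_clock_eq j
  have hΛ'0 : 0 ≤ (1 + 1 : ℝ) ^ ((5 : ℝ) * ((j : ℝ) - 1) / 2) :=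
    (Real.rpow_pos_of_pos (by norm_num) _).le
  have hΛ' : (1 + 1 : ℝ) ^ ((5 : ℝ) * ((j : ℝ) - 1) / 2) ≤ 177 / 1000 / q ^ 5 := by
    rw [wake_clock_pred_eq j]
    have h5 : 0 ≤ 1 / q ^ 5 := by positivity
    calc (2 : ℝ) ^ (-(5 : ℝ) / 2) * (1 / q ^ 5) ≤ 177 / 1000 * (1 / q ^ 5) :=
        mul_le_mul_of_nonneg_right two_rpow_neg_five_halves_le h5
      _ = 177 / 1000 / q ^ 5 := by ring
  -- squared amplitudes of the family shells from their energies
  have hsq : ∀ (i' : Fin 4) (j' : ℤ), i' ≠ 3 → j' ≤ -4 → S i' j' s ^ 2 ≤ 338 / 100 * wakeE i' j' := by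
    intro i' j' hi' hj'
    have h1 := h.defect_lower i' j' s hsτ
    have h2 := hfam i' j' hi' hj' s hs
    linarith
  -- own shell
  have hx : |S 0 j s| ≤ 26 / 100 * q := by
    refine abs_le_of_sq_le_sq ?_ (by positivity)
    have h1 := hsq 0 j (by decide) hj
    rw [wakeE_zero] at h1
    rw [mul_pow, hq2]; linarith
  have hu : |S 1 j s| ≤ 65 / 100 * q := by
    refine abs_le_of_sq_le_sq ?_ (by positivity)
    have h1 := hsq 1 j (by decide) hj
    rw [wakeE_one] at h1
    rw [mul_pow, hq2]; linarith
  have hr : |S 2 j s| ≤ 104 / 1000 * q := by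
    refine abs_le_of_sq_le_sq ?_ (by positivity)
    have h1 := hsq 2 j (by decide) hj
    rw [wakeE_two] at h1
    rw [mul_pow, hq2]; linarith
  -- the shell below (`j - 1 ≤ -5`)
  have hu' : |S 1 (j - 1) s| ≤ 92 / 100 * q := by
    refine abs_le_of_sq_le_sq ?_ (by positivity)
    have h1 := hsq 1 (j - 1) (by decide) (by omega)
    rw [wakeE_one, wake_scale_sq_pred] at h1
    have hq2' : 0 ≤ q ^ 2 := sq_nonneg q
    rw [mul_pow, hq2]; rw [← hq2] at h1; nlinarith
  have hr' : |S 2 (j - 1) s| ≤ 15 / 100 * q := by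
    refine abs_le_of_sq_le_sq ?_ (by positivity)
    have h1 := hsq 2 (j - 1) (by decide) (by omega)
    rw [wakeE_two, wake_scale_sq_pred] at h1
    have hq2' : 0 ≤ q ^ 2 := sq_nonneg q
    rw [mul_pow, hq2]; rw [← hq2] at h1; nlinarith
  -- the shell above (`j + 1`): old shell `-3` if `j = -4`, a family shell otherwise
  have hup : ∀ i' : Fin 4, i' ≠ 3 → i' ≠ 2 → |S i' (j + 1) s| ≤ 15 / 10 * q := by
    intro i' hi' hi'2
    refine abs_le_of_sq_le_sq ?_ (by positivity)
    rw [mul_pow]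
    by_cases hj4 : j = -4
    · have hF := h3 s hs i' hi'
      have hd := h.defect_lower i' (-3) s hsτ
      have hj3 : j + 1 = -3 := by omega
      rw [hj3]
      nlinarith
    · have hj5 : j + 1 ≤ -4 := by omega
      have h1 := hsq i' (j + 1) hi' hj5
      have hw := (wakeE_bounds hi' (j + 1)).2
      rw [wake_scale_sq_succ, ← hq2] at hw
      have hq2' : 0 ≤ q ^ 2 := sq_nonneg q
      nlinarith
  have hxp := hup 0 (by decide) (by decide)
  have hup1 := hup 1 (by decide) (by decide)
  -- the three rows
  have hq4 : 256 ≤ q ^ 2 * q ^ 2 := by nlinarith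
  have hq2pos : 0 < q ^ 2 := by positivity
  have hi' : i = 0 ∨ i = 1 ∨ i = 2 := by
    fin_cases i <;> simp_all
  rcases hi' with rfl | rfl | rfl
  · rw [hrows.1 S j s, wakeE_zero, ← hq2]
    refine (wake_rate_carrier hq hΛ hΛ'0 hΛ' hx hu hu').trans ?_
    rw [div_le_iff₀ hq2pos]
    nlinarith
  · rw [hrows.2.1 S j s, wakeE_one, ← hq2]
    refine (wake_rate_trigger hq hΛ hΛ'0 hΛ' hx hu hr hxp hu' hr').trans ?_
    rw [div_le_iff₀ hq2pos]
    nlinarith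
  · rw [hrows.2.2.1 S j s, wakeE_two, ← hq2]
    refine (wake_rate_relay hq hΛ hu hr hxp hup1).trans ?_
    rw [div_le_iff₀ hq2pos]
    nlinarith

/-- **THE WAKE FAMILY BOUND.** Along any pseudo-flow (`ε₀ = 1`, any defect constants) of a table with
the relay rows, started with the wake energy clauses (`F₀ i k ≤ wakeE i k`, `k ≤ −1`, `i ≠ 3`), and
with old shell `−3` under the epoch envelope on `[0, τ₁]` (`τ₁ ≤ 8`): for every active mode `i` and
every old shell `j ≤ −4`, `F_{i,j}(t) ≤ (1 + t/20)·wakeE i j` on `[0, τ₁]` (one-sided uniform bootstrap,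
slack factor `169/140`). [cite: Tao2016AveragedNS, §4 Lemma 4.1 (4.5), (4.9), (4.10)] -/
theorem wake_family_bound (h : PseudoFlowOn τ 1 α κ₁ κ₂ S₀ F₀ B₀ S F) (hτ : 0 < τ)
    (hrows : RelayRows α)
    (hwake : ∀ k : ℤ, k ≤ -1 → ∀ i : Fin 4, i ≠ 3 → F₀ i k ≤ wakeE i k)
    {τ₁ : ℝ} (hτ₁ : τ₁ ∈ Icc 0 τ) (hτ₁8 : τ₁ ≤ 8)
    (h3 : ∀ s ∈ Icc (0 : ℝ) τ₁, ∀ i : Fin 4, i ≠ 3 → F i (-3) s ≤ relayEnv₂ (-3)) :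
    ∀ (i : Fin 4) (j : ℤ), i ≠ 3 → j ≤ -4 → ∀ t ∈ Icc (0 : ℝ) τ₁,
      F i j t ≤ (1 + t / 20) * wakeE i j := by
  -- the uniform growth constant from the a priori class
  obtain ⟨M, hM0, hM⟩ := wake_apriori_abs h
  -- the family, indexed by (mode, shell)
  let ι := {x : Fin 4 × ℤ // x.1 ≠ 3 ∧ x.2 ≤ -4}
  have hgrow : ∀ x : ι, ∀ s ∈ Icc (0 : ℝ) τ₁, ∀ t ∈ Icc (0 : ℝ) τ₁, s ≤ t →
      F x.1.1 x.1.2 t - F x.1.1 x.1.2 s ≤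
        3 * M ^ 3 / (32 / 10000) * wakeE x.1.1 x.1.2 * (t - s) := by
    rintro ⟨⟨i, j⟩, hi, hj⟩ s hs t ht hst
    have hL : 3 * M ^ 3 ≤ 3 * M ^ 3 / (32 / 10000) * wakeE i j := by
      have hw := (wakeE_bounds hi j).1
      have hQ1 := wake_scale_sq_ge_one (show j ≤ 0 by omega)
      have hM3 : 0 ≤ 3 * M ^ 3 := by positivity
      have h32 : 32 / 10000 ≤ wakeE i j := by nlinarith
      calc 3 * M ^ 3 = 3 * M ^ 3 / (32 / 10000) * (32 / 10000) := by ring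
        _ ≤ 3 * M ^ 3 / (32 / 10000) * wakeE i j :=
            mul_le_mul_of_nonneg_left h32 (by positivity)
    refine pseudoFlowOn_energy_increment_le_const h hτ i j hs.1 hst (ht.2.trans hτ₁.2)
      fun u hu => ?_
    have huτ : u ∈ Icc 0 τ := ⟨hs.1.trans hu.1, hu.2.trans (ht.2.trans hτ₁.2)⟩
    exact (wake_crude_rate h hrows hM hi (by omega) huτ).trans hL
  have h0 : ∀ x : ι, F x.1.1 x.1.2 0 ≤ (1 + 0 / 20) * wakeE x.1.1 x.1.2 := by
    rintro ⟨⟨i, j⟩, hi, hj⟩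
    simp only [zero_div, add_zero, one_mul]
    rw [h.init_F]
    exact hwake j (by omega) i hi
  have himp : ∀ t ∈ Icc (0 : ℝ) τ₁,
      (∀ x : ι, ∀ s ∈ Icc (0 : ℝ) t, F x.1.1 x.1.2 s ≤ 169 / 140 * (1 + s / 20) * wakeE x.1.1 x.1.2) →
        ∀ x : ι, F x.1.1 x.1.2 t ≤ (1 + t / 20) * wakeE x.1.1 x.1.2 := by
    rintro t ht hweak ⟨⟨i, j⟩, hi, hj⟩
    have htτ : t ∈ Icc 0 τ := ⟨ht.1, ht.2.trans hτ₁.2⟩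
    have hfam : ∀ (i' : Fin 4) (j' : ℤ), i' ≠ 3 → j' ≤ -4 → ∀ s ∈ Icc 0 t,
        F i' j' s ≤ 169 / 100 * wakeE i' j' := by
      intro i' j' hi' hj' s hs
      have h1 : F i' j' s ≤ 169 / 140 * (1 + s / 20) * wakeE i' j' := hweak ⟨(i', j'), hi', hj'⟩ s hs
      have hs8 : s ≤ 8 := hs.2.trans (ht.2.trans hτ₁8)
      have hw0 := wakeE_nonneg i' j'
      have h2 : 169 / 140 * (1 + s / 20) ≤ 169 / 100 := by linarith
      exact h1.trans (mul_le_mul_of_nonneg_right h2 hw0)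
    have h3' : ∀ s ∈ Icc 0 t, ∀ i' : Fin 4, i' ≠ 3 → F i' (-3) s ≤ 16 := fun s hs i' hi' =>
      relayEnv₂_neg_three ▸ h3 s ⟨hs.1, hs.2.trans ht.2⟩ i' hi'
    have hrate : ∀ u ∈ Icc 0 t, quadTerm 1 α S i j u * S i j u ≤ wakeE i j / 20 :=
      fun u hu => wake_fine_rate h hrows htτ hfam h3' hi hj hu
    have hinc := pseudoFlowOn_energy_increment_le_const h hτ i j le_rfl ht.1 htτ.2 hrate
    rw [h.init_F] at hinc
    have h00 := hwake j (by omega) i hi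
    show F i j t ≤ (1 + t / 20) * wakeE i j
    linarith
  have hψc : ContinuousOn (fun t : ℝ => 1 + t / 20) (Icc 0 τ₁) := by fun_prop
  have hψpos : ∀ t ∈ Icc (0 : ℝ) τ₁, 0 < 1 + t / 20 := fun t ht => by linarith [ht.1]
  have key := bootstrap_family_oneSided_slack (u := fun x : ι => fun t => F x.1.1 x.1.2 t)
    (p := fun x : ι => wakeE x.1.1 x.1.2) (ψ := fun t : ℝ => 1 + t / 20) (τ := τ₁)
    (L := 3 * M ^ 3 / (32 / 10000)) (θ := 169 / 140) (by norm_num) (fun x => wakeE_nonneg _ _)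
    (by positivity) hψc hψpos hgrow h0 himp
  intro i j hi hj t ht
  exact key ⟨(i, j), hi, hj⟩ t ht

/-! ### The registered stub -/

/-- **STUB `stub_wake` of LINE `window_v2` (registered signature, verbatim) — THE FAR WAKE.** Along any
`(η,η)`-pseudo-flow (`η = 1e-8`) of a table in `E₂(64)` with the completion-relay rows, started with
the wake energy clauses of `W₂` and with old shell `−3` under the epoch envelope on the hop window
`[0, τ₁]` (`τ₁ ≤ 8`), the energies of the old shells `k ≤ −4` stay under `relayEnv₂`, and the wake
energy clauses re-enter, one shell deeper (`k ≤ −5`), after rescaling by any `a ≥ 17/20`. MODEL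
lattice (Tao 2016 §4); nothing about the Navier–Stokes equations. [this file] -/
theorem stub_wake :
  ∀ α : Fin 4 → Fin 4 → Fin 4 → ℤ × ℤ × ℤ → ℝ, InTableClass 64 α → RelayRows α →
    ∀ (τ : ℝ) (S₀ F₀ B₀ : Fin 4 → ℤ → ℝ) (S F : Fin 4 → ℤ → ℝ → ℝ), 0 < τ →
      PseudoFlowOn τ 1 α (1 / 10 ^ 8) (1 / 10 ^ 8) S₀ F₀ B₀ S F →
      (∀ k : ℤ, k ≤ -1 → ∀ i : Fin 4, i ≠ 3 → F₀ i k ≤ wakeE i k) →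
      ∀ τ₁ ∈ Icc (0 : ℝ) τ, τ₁ ≤ 8 →
        (∀ s ∈ Icc (0 : ℝ) τ₁, ∀ i : Fin 4, i ≠ 3 → F i (-3) s ≤ relayEnv₂ (-3)) →
        (∀ s ∈ Icc (0 : ℝ) τ₁, ∀ (i : Fin 4) (k : ℤ), k ≤ -4 → i ≠ 3 → F i k s ≤ relayEnv₂ k) ∧
        ∀ a : ℝ, 17 / 20 ≤ a →
          ∀ k : ℤ, k ≤ -5 → ∀ i : Fin 4, i ≠ 3 → F i (1 + k) τ₁ / a ^ 2 ≤ wakeE i k := by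
  intro α _hE hrows τ S₀ F₀ B₀ S F hτ hflow hwake τ₁ hτ₁ hτ₁8 h3
  have key := wake_family_bound hflow hτ hrows hwake hτ₁ hτ₁8 h3
  refine ⟨?_, ?_⟩
  · intro s hs i k hk hi
    have h1 := key i k hi hk s hs
    have hs8 : s ≤ 8 := hs.2.trans hτ₁8
    have hw := (wakeE_bounds hi k).2
    have hQ : 0 < (2 : ℝ) ^ (-(k : ℝ)) := Real.rpow_pos_of_pos (by norm_num) _
    have henv : relayEnv₂ k = 2 * (2 : ℝ) ^ (-(k : ℝ)) := by
      unfold relayEnv₂; rw [if_pos (by omega)]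
    rw [henv]
    have hw0 := wakeE_nonneg i k
    have h2 : (1 + s / 20) * wakeE i k ≤ 14 / 10 * wakeE i k :=
      mul_le_mul_of_nonneg_right (by linarith) hw0
    linarith
  · intro a ha k hk i hi
    have h1 := key i (1 + k) hi (by omega) τ₁ ⟨hτ₁.1, le_rfl⟩
    have ha2 : 289 / 400 ≤ a ^ 2 := by nlinarith
    have hpos : 0 < a ^ 2 := by positivity
    rw [div_le_iff₀ hpos]
    have hhalf : wakeE i (1 + k) = wakeE i k / 2 := by
      unfold wakeE
      rw [show (1 + k : ℤ) = k + 1 by ring, wake_scale_sq_succ]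
      ring
    rw [hhalf] at h1
    have hw0 := wakeE_nonneg i k
    have h2 : (1 + τ₁ / 20) * (wakeE i k / 2) ≤ 14 / 10 * (wakeE i k / 2) :=
      mul_le_mul_of_nonneg_right (by linarith) (by linarith)
    nlinarith

end Summit.NavierStokesRegularity.NavierStokesRegularity.Cruxes.RelayFrontStep.Window2
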